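import Mathlib
import HarnessLib
import Summits.AtomisticToContinuum.Crystallization.Theses.PhononSlackCertificates
import Literature.MathematicalPhysics.StatisticalMechanics.LennardJonesClusters

/-!
# Route PhononSlackCertificates — the Assembly item (stmt-AtomisticToContinuum-14971)

`Assembly := FarFieldGapR → NearFieldConvexity → NearFarGlueR → HullBridge → PeriodicGivenLayered →
HullCriterion → WindowOptimality → CrysEnergyLimit → Crystallization` is the informal shape of the
route's deciding theorem `closes`; its proof is that theorem's body: pure logic over the eight
antecedents plus the PROVED Literature theorem `LennardJonesGroundStatesExist_holds` (a sequence of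
Lennard-Jones ground states exists) and the identification `⨅ = e(P)` for a least element
(`IsLeast.csInf_eq`).
-/

namespace Summit.AtomisticToContinuum.Crystallization.Theorems

open Summit.AtomisticToContinuum.Crystallization.Theses.PhononSlackCertificates
open Literature.MathematicalPhysics.StatisticalMechanics

/-- **Assembly of route PhononSlackCertificates** (item stmt-AtomisticToContinuum-14971): the
repaired far field `FarFieldGapR`, the near field `NearFieldConvexity` and the glue `NearFarGlueR`
give the coercive two-shell gap; `HullBridge` turns it (with the near field and the energy limit)
into layered windows of every sequence of ground states; `PeriodicGivenLayered` upgrades them to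
periodic windows; `HullCriterion` yields the positional conjunct `IsCrystallizing lennardJones 3`;
and for the energetic conjunct one picks a sequence of ground states (they exist:
`LennardJonesGroundStatesExist_holds`), its periodic window `P`, which is a least-energy periodic
configuration by `WindowOptimality`, so `⨅_Q e(Q) = e(P)` (`IsLeast.csInf_eq`) and
`CrysEnergyLimit` is exactly `E(N)/N → e(P)`. -/
theorem phononSlackCertificates_assembly_proof :
    Summit.AtomisticToContinuum.Crystallization.Theses.PhononSlackCertificates.Assembly := by
  unfold Summit.AtomisticToContinuum.Crystallization.Theses.PhononSlackCertificates.Assembly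
  intro h_FarFieldGapR h_NearFieldConvexity h_NearFarGlueR h_HullBridge h_PeriodicGivenLayered
    h_HullCriterion h_WindowOptimality h_CrysEnergyLimit
  -- (1) the coercive two-shell gap, from the repaired far field and the near field through the glue
  have hCG : CoerciveTwoShellGap := h_NearFarGlueR h_FarFieldGapR h_NearFieldConvexity
  -- (2) layered windows of every sequence of ground states
  -- buildfix 2026-08-19: HullBridge was restated (route rev 5, crux-only step A): its conclusion is the
  -- LayeredWindows body and it no longer takes CrysEnergyLimit.
  have hLW : LayeredWindows := h_HullBridge hCG h_NearFieldConvexity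
  -- (3) stacking selection inside the hull: layered windows ⇒ periodic windows
  have hPW : PeriodicWindows := fun y hy => h_PeriodicGivenLayered y hy (hLW y hy)
  -- (4) positional conjunct (ii): hull criterion
  have hpos : IsCrystallizing lennardJones 3 := h_HullCriterion hPW
  -- (5) energetic conjunct (i): ground states exist for every N (proved Literature theorem); their
  -- periodic window P is a least-energy periodic configuration, hence ⨅ = e(P), and E(N)/N → e(P).
  have hex : LennardJonesGroundStatesExist := LennardJonesGroundStatesExist_holds
  obtain ⟨x, hx⟩ : ∃ x : (N : ℕ) → (Fin N → EuclideanSpace ℝ (Fin 3)),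
      ∀ N, IsGroundState lennardJones (x N) :=
    ⟨fun N => (hex N).choose, fun N => (hex N).choose_spec⟩
  obtain ⟨P, hP⟩ := hPW x hx
  have hleast : IsLeast (Set.range fun Q : PeriodicConfiguration 3 => Q.energyPerParticle lennardJones)
      (P.energyPerParticle lennardJones) := h_WindowOptimality x hx P hP
  have hinf : (⨅ Q : PeriodicConfiguration 3, Q.energyPerParticle lennardJones) =
      P.energyPerParticle lennardJones := hleast.csInf_eq
  have hlim : Filter.Tendsto (fun N : ℕ => groundStateEnergy lennardJones 3 N / N) Filter.atTop
      (nhds (P.energyPerParticle lennardJones)) := by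
    have h0 : CrysEnergyLimit := h_CrysEnergyLimit
    unfold CrysEnergyLimit at h0
    rw [hinf] at h0
    exact h0
  exact ⟨⟨P, hleast, hlim⟩, hpos⟩

end Summit.AtomisticToContinuum.Crystallization.Theorems
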